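import Mathlib
import Summits.MatrixMultiplication.MatrixMultiplication.Theses.FidelityWitnesses
import Summits.MatrixMultiplication.MatrixMultiplication.Theorems.FidelityThesis.Negative.SummitEquivalence
import Summits.MatrixMultiplication.MatrixMultiplication.Theorems.FidelityThesis.Negative.AsymptoticRankConjecture
import Literature.Computability.AlgebraicComplexity.AsymptoticRankConjecture
import Literature.Computability.AlgebraicComplexity.AsymptoticSpectrum
import Literature.Computability.AlgebraicComplexity.AsymptoticSpectrumDuality
import Literature.Computability.AlgebraicComplexity.QuantumFunctionalPoint
import Literature.Computability.AlgebraicComplexity.StrassenPreorder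
import Literature.Computability.AlgebraicComplexity.TensorSemiring
import Literature.Computability.AlgebraicComplexity.TripartitionTensor
import Literature.Computability.AlgebraicComplexity.AsymptoticRankMatMul
import Literature.Computability.AlgebraicComplexity.MatrixMultiplicationExponent

/-!
# Crux-strategist sketch for `FidelityWitnesses.FidelityThesis` (stmt-MatrixMultiplication-4956)

Typed companions of `STRATEGY-CENSUS.md` (planner-cstrat-stmt-MatrixMultiplication-4956-0,
2026-08-16).  Every statement named in the census under Transfer / Strengthen / Decomposition /
Negation is a `def … : Prop` here, so that "typed" means "elaborates on the farm"; the cheap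
implications between them and the crux are proved (no `sorry` anywhere; the open statements are
`def`s, never asserted — this file registers no line and no stub).

Frame (kernel-checked elsewhere and re-derived here from the landed
`Theorems/FidelityThesis/Negative/SummitEquivalence.lean`, p83600):
`FidelityThesis ↔ 2 < ω(ℂ) ↔ ¬ MatrixMultiplication`.
-/

set_option linter.unusedVariables false
set_option linter.dupNamespace false

namespace Summit.MatrixMultiplication.MatrixMultiplication.Cruxes.FidelityThesis.Strategist

open scoped BigOperators
open Literature.Computability.AlgebraicComplexity
open Summit.MatrixMultiplication.MatrixMultiplication.Theses.FidelityWitnesses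
  (FidelityThesis DiagonalPowerDecay)
open Summit.MatrixMultiplication.MatrixMultiplication.Theorems
  (two_lt_omega_of_fidelityThesis omega_le_two_of_not_fidelityThesis
   fidelityThesis_omega_le_two_of_asymptoticRankConjecture)

/-- The square format. -/
abbrev Tn (n : ℕ) : Type := Fin n × Fin n → Fin n × Fin n → Fin n × Fin n → ℂ

/-! ## §0 Frame -/

/-- `2 < ω(ℂ) → crux` (contrapositive of the landed `omega_le_two_of_not_fidelityThesis`). -/
theorem crux_of_two_lt_omega (h : 2 < omega ℂ) : FidelityThesis := by
  by_contra hX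
  exact absurd (omega_le_two_of_not_fidelityThesis hX) (not_le.2 h)

/-- The crux is exactly `2 < ω(ℂ)`. -/
theorem crux_iff_two_lt_omega : FidelityThesis ↔ 2 < omega ℂ :=
  ⟨two_lt_omega_of_fidelityThesis, crux_of_two_lt_omega⟩

/-! ## §T Transfer — the dual object every transferred argument needs -/

/-- **T-b/T-c (typed).** A DARK POINT AT `⟨2,2,2⟩`: a universal spectral point of complex
3-tensors exceeding the flattening value `4` at `⟨2,2,2⟩`.  This is what the slice-rank /
irreversibility arguments of the solved siblings would have to produce when the host is the unit
tensor; it was the target of the retired route `DarkPointsByLogic` (closed `not-a-thesis`: it is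
`¬ MatrixMultiplication` by Strassen duality). -/
def DarkPointAtTwo : Prop :=
  ∃ F : SpectralMap ℂ, IsUniversalSpectralPoint ℂ F ∧ (4 : ℝ) < F (matMulTensor ℂ 2 2 2)

/-- Easy half: a dark point at `⟨2,2,2⟩` proves the crux (duality `F ≤ R̃`, `R̃(⟨2,2,2⟩) = 2^ω`). -/
theorem crux_of_darkPointAtTwo (h : DarkPointAtTwo) : FidelityThesis := by
  obtain ⟨F, hF, h4⟩ := h
  apply crux_of_two_lt_omega
  have h1 : F (matMulTensor ℂ 2 2 2) ≤ asymptoticRank (matMulTensor ℂ 2 2 2) :=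
    ((strassen_duality_asymptoticRank_holds (K := ℂ)) (matMulTensor ℂ 2 2 2)).1 F hF
  have h2 : asymptoticRank (matMulTensor ℂ 2 2 2) = (2 : ℝ) ^ omega ℂ := by
    simpa using asymptoticRank_matMulTensor ℂ 2 (by norm_num)
  have h3 : (4 : ℝ) < (2 : ℝ) ^ omega ℂ := by linarith [h1.trans_eq h2]
  have h4' : (2 : ℝ) ^ (2 : ℝ) < (2 : ℝ) ^ omega ℂ := by norm_num; exact h3
  exact (Real.rpow_lt_rpow_left_iff (by norm_num : (1 : ℝ) < 2)).1 h4'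

/-! ## §S Strengthen — candidate `S⁺` and why each is `≥` the crux -/

/-- **S1** `FG(δ′)`, the dead line `Sketch`'s stub: n-free fidelity growth. `≥` crux (p96544). -/
def FidelityGrowth : Prop :=
  ∃ δ' : ℝ, 0 < δ' ∧ δ' < 3 / 2 ∧ ∃ C : ℝ, 0 < C ∧
    ∀ (n r : ℕ) (S : Tn n), tensorRank S ≤ r →
      ‖∑ a, ∑ b, ∑ c, S a b c * matMulTensor ℂ n n n a b c‖ ^ 2 ≤
        C * (r : ℝ) ^ (3 / 2 - δ') * ∑ a, ∑ b, ∑ c, ‖S a b c‖ ^ 2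

/-- **S2** UNIFORM-ε crux (Disproof.lean §5 open variant (i)): one `ε` for the whole curve. -/
def UniformEpsThesis : Prop :=
  ∃ δ : ℝ, 0 < δ ∧ ∃ c : ℝ, 0 < c ∧ ∃ ε : ℝ, 0 < ε ∧ ∀ n r : ℕ, 1 ≤ n →
    (r : ℝ) ≤ c * (n : ℝ) ^ (2 + δ) → ∀ S : Tn n, tensorRank S ≤ r →
      ‖∑ a, ∑ b, ∑ c, S a b c * matMulTensor ℂ n n n a b c‖ ^ 2 ≤
        (1 - ε) * (n : ℝ) ^ 3 * ∑ a, ∑ b, ∑ c, ‖S a b c‖ ^ 2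

/-- S2 is a strengthening: it implies the crux by moving `∃ ε` inside. -/
theorem crux_of_uniformEps (h : UniformEpsThesis) : FidelityThesis := by
  obtain ⟨δ, hδ, c, hc, ε, hε, hgap⟩ := h
  exact ⟨δ, hδ, c, hc, fun n r hn hr => ⟨ε, hε, hgap n r hn hr⟩⟩

/-- **S3** ALL-CHARACTERISTICS form: `ω(K) > 2` for every field. Strictly stronger on its face
(whether `ω` depends on the characteristic is open, BCS Problem 15.3); no induction bought. -/
def AllCharacteristicsThesis : Prop :=
  ∀ (K : Type) [Field K], 2 < omega K

theorem crux_of_allCharacteristics (h : AllCharacteristicsThesis) : FidelityThesis :=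
  crux_of_two_lt_omega (h ℂ)

/-- **S4** INCREMENT LAW (the inductive-step strengthening): each unit step `n → n + 1` adds
`c·n^{1+δ}` to the border rank of `⟨n,n,n⟩`.  Summing gives `R̲(⟨n,n,n⟩) ≥ c'·n^{2+δ}`, hence the
crux; the census explains why the step is itself beyond every method at each large `n`. -/
def IncrementLaw : Prop :=
  ∃ δ : ℝ, 0 < δ ∧ ∃ c : ℝ, 0 < c ∧ ∀ n : ℕ, 1 ≤ n →
    (algBorderRank (matMulTensor ℂ n n n) : ℝ) + c * (n : ℝ) ^ (1 + δ) ≤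
      algBorderRank (matMulTensor ℂ (n + 1) (n + 1) (n + 1))

/-- **S5** KRONECKER SUPER-MULTIPLICATIVITY with defect (the `DoublingDefectLaw` of the failed
card, triage r1-1/r1-2): `R̲(⟨2n,2n,2n⟩) ≥ (4 + η)·R̲(⟨n,n,n⟩)`. -/
def DoublingDefectLaw : Prop :=
  ∃ η : ℝ, 0 < η ∧ ∀ n : ℕ, 1 ≤ n →
    (4 + η) * (algBorderRank (matMulTensor ℂ n n n) : ℝ) ≤
      algBorderRank (matMulTensor ℂ (2 * n) (2 * n) (2 * n))

/-! ## §D Decomposition — the typed splits and their glue -/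

/-- **D3, piece 1.** `¬ARC`: some tensor has asymptotic rank above its format (BCS Problem 15.5
answered positively; the NEGATION of route AsymptoticSpectrum's item `FormatBound`, stmt-8616, in
`R̃`-currency).  Necessary for the crux (`⟨2,2,2⟩` in format `4×4×4` is an instance). -/
def NotARC : Prop := ¬ BCS1997_problem155_negative ℂ

/-- **D3, piece 2.** `⟨2,2,2⟩` IS ARC-COMPLETE: if any tensor is dark from above, so is `⟨2,2,2⟩`
(equivalently `ω(ℂ) = 2 → ARC`).  Strassen's "limited universality" `σ(d) ≤ (4/3)·σ(MM₂)`
(Kaski–Michałek arXiv:2404.06427 §1.1) is the known approximation; the exact statement is open. -/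
def MMTwoARCComplete : Prop := ¬ BCS1997_problem155_negative ℂ → 2 < omega ℂ

/-- The split is EXACT: crux ↔ (D3.1 ∧ D3.2). Glue direction. -/
theorem crux_of_notARC_of_complete (h₁ : NotARC) (h₂ : MMTwoARCComplete) : FidelityThesis :=
  crux_of_two_lt_omega (h₂ h₁)

/-- … and both pieces are CONSEQUENCES of the crux (so neither is the crux reworded, and neither
alone is known to imply it): piece 1 via the landed `ARC → ω ≤ 2`. -/
theorem notARC_of_crux (h : FidelityThesis) : NotARC := fun hARC =>
  absurd (fidelityThesis_omega_le_two_of_asymptoticRankConjecture hARC)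
    (not_le.2 (two_lt_omega_of_fidelityThesis h))

theorem complete_of_crux (h : FidelityThesis) : MMTwoARCComplete := fun _ =>
  two_lt_omega_of_fidelityThesis h

theorem crux_iff_split : FidelityThesis ↔ NotARC ∧ MMTwoARCComplete :=
  ⟨fun h => ⟨notARC_of_crux h, complete_of_crux h⟩, fun h => crux_of_notARC_of_complete h.1 h.2⟩

/-- **D4, piece 1 (hosting).** CHEAP HOSTING of Pratt's tripartition tensors in matrix
multiplication, at rate `< 8` in Strassen's asymptotic preorder on `TensorClass ℂ` (the dead line
ProofB's constructive stub; unit-tensor routing gives rate `8`). -/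
def CheapHosting : Prop :=
  ∃ ε : ℝ, 0 < ε ∧ ∃ k₀ : ℕ, ∀ k : ℕ, k₀ ≤ k → ∃ n : ℕ, 1 ≤ n ∧ ((n : ℝ)) ^ 2 ≤ (8 - ε) ^ k ∧
    AsympLe (fun x y : TensorClass ℂ => x ≤ y)
      (TensorClass.mk (tripartitionTensor ℂ k)) (TensorClass.mk (matMulTensor ℂ n n n))

/-- **D4, piece 2 (dark point at `T_k`).** Pratt 2024 Cor 1.11's CONCLUSION, unconditionally
(under the Set Cover Conjecture it is a theorem in print; unconditionally it refutes ARC at the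
explicit tight tensors `T_k`). -/
def PrattBound : Prop :=
  ∀ ε : ℝ, 0 < ε → ∃ k₀ : ℕ, ∀ k : ℕ, k₀ ≤ k →
    (8 - ε) ^ k < asymptoticRank (tripartitionTensor ℂ k)

/-- **D5 (catalysis split of dead line ProofC, triage r1-1 sharpening).** Piece 1: a dark point
from BELOW at an explicit tensor `s` (asymptotic subrank under an explicit ceiling `q`). -/
def LowerDarkness {ι κ μ : Type} [Fintype ι] [Fintype κ] [Fintype μ]
    (s : ι → κ → μ → ℂ) (q : ℝ) : Prop :=
  asymptoticSubrank ℂ s ≤ q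

/-- Piece 2: a catalytic distillation protocol — `⟨2,2,2⟩ ⊠ s` has asymptotic subrank at least
`4q + η` (constructive: exhibit degenerations of Kronecker powers). -/
def Catalysis {ι κ μ : Type} [Fintype ι] [Fintype κ] [Fintype μ]
    (s : ι → κ → μ → ℂ) (q η : ℝ) : Prop :=
  4 * q + η ≤ asymptoticSubrank ℂ (kroneckerTensor (matMulTensor ℂ 2 2 2) s)

/-! ## §N Negation — the shape of the obstruction lemmas the barriers give

Each catalogued barrier is a theorem `ω_M ≥ 2 + η_M` about a METHOD CLASS `M` (laser method on
`CW_q`-powers, universal method, fixed irreversible intermediate, STPP in bounded-exponent abelian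
groups, …).  The union of the classes is not all bilinear algorithms — the trivial host `⟨r⟩` with
`r = R(⟨n,n,n⟩)` lies outside every one (irreversibility `1`) — so the obstruction lemmas do not
assemble into the crux.  The only assembling statement would be a COMPLETENESS claim for a class,
which is false as stated; recorded here as the (false) shape, not as a stub. -/

/-- The (false) completeness shape: "every algorithm is an `M`-algorithm" for a class `M` given as
a predicate on hosts; with `M := irreversible hosts` it fails at the unit tensors. Not used. -/
def ClassCompleteness (M : TensorClass ℂ → Prop) : Prop :=
  ∀ n r : ℕ, TensorClass.mk (matMulTensor ℂ n n n) ≤ TensorClass.mk (unitTensor ℂ r) →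
    ∃ h : TensorClass ℂ, M h ∧ TensorClass.mk (matMulTensor ℂ n n n) ≤ h ∧
      h ≤ TensorClass.mk (unitTensor ℂ r)

end Summit.MatrixMultiplication.MatrixMultiplication.Cruxes.FidelityThesis.Strategist
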